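import Summits.BirchSwinnertonDyer.BirchSwinnertonDyer.Theorems.EisensteinPrimesDatumSelmerQuotientTorsionFiniteGeneric
import Summits.BirchSwinnertonDyer.BirchSwinnertonDyer.Theorems.EisensteinPrimesTwoVariableMuLambdaOfRubinTrivial
import Literature.NumberTheory.EllipticCurves.KellerYin2024.AnomalousImprimitiveLambdaInvariants
import Literature.NumberTheory.EllipticCurves.AnticyclotomicPrimeDecompositionSplitProofs
import Literature.NumberTheory.EllipticCurves.StrictSelmerRankOneDegreeOneProofs
import HarnessLib

/-!
# `(H¹_{𝓕_nr^{Sf}}/H¹_{𝓕_nr})[p]` is FINITE for Keller–Yin's character modules `(F/𝒪)(θ)` over the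
# anticyclotomic tower — the local half of "`𝓗_w(K_∞)` is `Λ`-cotorsion" IN THE KERNEL

Cell `bsd-eis` (home `run/shared/lean/pub/bsd-eis/`), seat `bsd-eis-k5-c2` g11, crux 2
`GoodLatticeBDPValue` (stmt-BirchSwinnertonDyer-19032), line `halves`, OPTION (B0), Stage C of the
"`Q[p]` finite" port (MEMO-11 §5): the generic theorems
`DatumSelmerQuotientTorsionFiniteGeneric.finite_torsionBy_quotient` (Stage B) and
`InertiaTorsionFiniteGeneric` (Stage A) INSTANTIATED at the character module
`charModule ∅ θ = (ℚ_p/ℤ_p)(θ)` (divisible, `p`-torsion of order `p`, open stabilisers) and at the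
crux's data (`K` imaginary quadratic, `p` odd, `κ` anticyclotomic, `Sf` = the primes of `K` over
`N_E` with (Heeg) for `N_E` and `p ∤ N_E`: every `w ∈ Sf` is split over `ℚ` and `w ∤ p`, hence
FINITELY DECOMPOSED in `K_∞` by Brink 2007 Thm. 2, tree theorem
`ZpExtension.decomp_not_le_kerSubgroup_of_isAnticyclotomic_holds`). Consequence: in the typed
`S`-relaxation input `prop125_residualPair_unrSelmer_quotient` the clause "`Q[p]` finite" is now a
KERNEL theorem; only the corank VALUE `Σ λ𝒫_w(θ)` (Pollack–Weston A.2 surjectivity + Lemma 1.1.1)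
remains typed.

HONEST FRAMING: theorems only; nothing booked; BSD is proved for no curve.
-/

set_option linter.dupNamespace false
set_option autoImplicit false

noncomputable section

open scoped Classical AddSubgroup

open WeierstrassCurve NumberField IsDedekindDomain Field Rat.HeightOneSpectrum
  Literature.NumberTheory.EllipticCurves Literature.NumberTheory.EllipticCurves.ModularForms
  Literature.NumberTheory.QuadraticFields Literature.NumberTheory.EllipticCurves.Rank1Residual
  Literature.NumberTheory.EllipticCurves.Castella2018 Literature.NumberTheory.EllipticCurves.GreenbergSelmer
  Literature.NumberTheory.EllipticCurves.GreenbergVatsal2000 Literature.NumberTheory.GaloisRepresentations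
  Literature.NumberTheory.EllipticCurves.CastellaGrossiLeeSkinner2022
  Literature.NumberTheory.EllipticCurves.KellerYin2024
open Summit.BirchSwinnertonDyer.BirchSwinnertonDyer.Theorems
  Summit.BirchSwinnertonDyer.BirchSwinnertonDyer.Theorems.IwasawaTwoVariable
  Summit.BirchSwinnertonDyer.BirchSwinnertonDyer.Theorems.DatumSelmerQuotientTorsionFiniteGeneric

namespace Summit.BirchSwinnertonDyer.BirchSwinnertonDyer.Theorems.UnrSelmerQuotientTorsionFiniteChar

/-! ## §1 The character module `(ℚ_p/ℤ_p)(θ)`: `p`-divisible, `#(·)[p] = p` -/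

section CharModule

variable {K : Type} [Field K] {p : ℕ} [Fact p.Prime]
  (θ : FramedGaloisRep K (padicCoeffIntegers (∅ : Set (PadicAlgCl p))) 1)

/-- `#((F/𝒪)(θ))[p] = p` (`≅ (ℚ_p/ℤ_p)[p]`). [folklore] -/
theorem natCard_torsionBy_charModule :
    Nat.card ((charModule (∅ : Set (PadicAlgCl p)) θ)[(p : ℤ)]) = p := by
  obtain ⟨e⟩ := nonempty_charModule_addEquiv_pruferQuot θ
  rw [Nat.card_congr (torsionByEquiv e p).toEquiv, PruferQuot.natCard_torsionBy]

/-- `(F/𝒪)(θ)` is `p`-divisible (`≅ ℚ_p/ℤ_p` as a group). [folklore] -/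
theorem exists_nsmul_eq_charModule (m : charModule (∅ : Set (PadicAlgCl p)) θ) :
    ∃ m' : charModule (∅ : Set (PadicAlgCl p)) θ, p • m' = m := by
  have hp : p.Prime := Fact.out
  obtain ⟨e⟩ := nonempty_charModule_addEquiv_pruferQuot θ
  obtain ⟨y, hy⟩ := PruferQuot.divisible p (m := (p : ℤ)) (Int.natCast_ne_zero.mpr hp.ne_zero) (e m)
  refine ⟨e.symm y, e.injective ?_⟩
  rw [map_nsmul, e.apply_symm_apply, ← natCast_zsmul, hy]

end CharModule

/-! ## §2 Primes over `N` under (Heeg) are split, hence finitely decomposed in the anticyclotomic tower -/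

section Split

variable {K : Type} [Field K] [NumberField K]

/-- **A place `w ∋ N` of an imaginary quadratic `K` with (Heeg) for `N` has `e(w|ℚ) = f(w|ℚ) = 1`.**
The rational prime `ℓ` under `w` divides `N` (else `gcd(ℓ, N) = 1 ∈ w`), so `ℓ` splits in `K` by
(Heeg), and in a quadratic field with two primes above `ℓ` every place above `ℓ` has degree one
(`ramificationIdx_eq_one_and_inertiaDeg_eq_one_of_ncard_primesOver_eq_two`).
[cite: GrossLMS1991, §1 (p. 235) (Heegner hypothesis)] -/
theorem ramificationIdx_inertiaDeg_eq_one_of_heegner (hK : IsImaginaryQuadratic K) {N : ℕ}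
    (hH : SatisfiesHeegnerHypothesis N K) (w : HeightOneSpectrum (𝓞 K))
    (hw : ((N : ℤ) : 𝓞 K) ∈ w.asIdeal) :
    w.asIdeal.ramificationIdx (𝓞 ℚ) = 1 ∧ w.asIdeal.inertiaDeg (𝓞 ℚ) = 1 := by
  -- the place of `ℚ` under `w` and its prime `ℓ`
  set u : HeightOneSpectrum (𝓞 ℚ) := w.under (𝓞 ℚ) with hu
  haveI : w.asIdeal.LiesOver u.asIdeal := ⟨rfl⟩
  haveI := Fact.mk (primesEquiv u).2
  have hℓp : (primesEquiv u : ℕ).Prime := (primesEquiv u).2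
  have hℓu : ((primesEquiv u : ℕ) : 𝓞 ℚ) ∈ u.asIdeal :=
    (natCast_mem_asIdeal_iff_eq_primesEquiv_symm u (primesEquiv u).2).mpr
      (by rw [Subtype.coe_eta, Equiv.symm_apply_apply])
  have hℓw : ((primesEquiv u : ℕ) : 𝓞 K) ∈ w.asIdeal := by
    have h : algebraMap (𝓞 ℚ) (𝓞 K) ((primesEquiv u : ℕ) : 𝓞 ℚ) ∈ w.asIdeal := by
      rw [← Ideal.mem_comap]; exact hℓu
    rwa [map_natCast] at h
  have hw' : ((N : ℕ) : 𝓞 K) ∈ w.asIdeal := by exact_mod_cast hw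
  -- `ℓ ∣ N`: otherwise `1 = a ℓ + b N ∈ w`
  have hℓN : (primesEquiv u : ℕ) ∣ N := by
    by_contra hnd
    have hcop : IsCoprime ((primesEquiv u : ℕ) : ℤ) (N : ℤ) :=
      Nat.isCoprime_iff_coprime.mpr ((Nat.Prime.coprime_iff_not_dvd hℓp).mpr hnd)
    obtain ⟨a, b, hab⟩ := hcop
    have h1 : (1 : 𝓞 K) ∈ w.asIdeal := by
      have e := congrArg (fun z : ℤ ↦ (z : 𝓞 K)) hab
      push_cast at e
      rw [← e]
      exact w.asIdeal.add_mem (w.asIdeal.mul_mem_left _ hℓw) (w.asIdeal.mul_mem_left _ hw')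
    exact w.isPrime.ne_top ((Ideal.eq_top_iff_one _).mpr h1)
  -- `ℓ` splits in `K`
  have h2 : ((Ideal.span {((primesEquiv u : ℕ) : ℤ)}).primesOver (𝓞 K)).ncard = 2 := hH _ hℓp hℓN
  exact ramificationIdx_eq_one_and_inertiaDeg_eq_one_of_ncard_primesOver_eq_two (primesEquiv u : ℕ)
    hK.1 h2 w hℓw

/-- **Primes of `K` over `N` are finitely decomposed in the anticyclotomic tower** (`K` imaginary
quadratic, `p` odd, (Heeg) for `N`): for `w ∋ N`, `w ∤ p`, the decomposition group `D_w` is not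
contained in `ker κ` — Brink 2007 Thm. 2 (tree theorem
`ZpExtension.decomp_not_le_kerSubgroup_of_isAnticyclotomic_holds`) at a split prime (§2).
[cite: Brink2007, Thm. 2 (pp. 2134–2135) and Cor. 1 (p. 2136)] -/
theorem exists_mem_decomp_apply_ne_one_of_heegner {p : ℕ} [Fact p.Prime] (hK : IsImaginaryQuadratic K)
    (hp : 2 < p) {N : ℕ} (hH : SatisfiesHeegnerHypothesis N K) (κ : ZpExtension K p)
    (hκ : κ.IsAnticyclotomic) (w : HeightOneSpectrum (𝓞 K)) (hw : ((N : ℤ) : 𝓞 K) ∈ w.asIdeal)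
    (hpw : ((p : ℕ) : 𝓞 K) ∉ w.asIdeal) :
    ∃ δ ∈ decomp (K := K) w, κ δ ≠ 1 := by
  obtain ⟨he, hf⟩ := ramificationIdx_inertiaDeg_eq_one_of_heegner hK hH w hw
  have h := ZpExtension.decomp_not_le_kerSubgroup_of_isAnticyclotomic_holds (K := K) (p := p) hK
    (by omega) κ hκ w hpw he hf
  obtain ⟨δ, hδ, hnot⟩ := SetLike.not_le_iff_exists.mp h
  exact ⟨δ, hδ, fun h1 ↦ hnot (ZpExtension.mem_kerSubgroup.mpr h1)⟩

end Split

/-! ## §3 `(H¹_{𝓕_nr^{Sf}}/H¹_{𝓕_nr})[p]` is finite for `(F/𝒪)(θ)` -/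

section Quotient

variable {K : Type} [Field K] [NumberField K] {p : ℕ} [Fact p.Prime]

/-- **`(H¹_{𝓕_nr^{Sf}}(K_∞, (F/𝒪)(θ)) / H¹_{𝓕_nr}(K_∞, (F/𝒪)(θ)))[p]` is FINITE** for `K` imaginary
quadratic, `p` odd, `κ` anticyclotomic with topological generator `γ`, any `vbar`, any character
`θ : Γ_K → GL₁(ℤ_p)` and `Sf` = the primes of `K` over `N` with (Heeg) for `N`: Stage B
(`finite_torsionBy_quotient`, generic module, any data) at the character module (`p`-divisible,
`#(·)[p] = p`, open stabilisers) with every `w ∈ Sf`, `w ∤ p`, finitely decomposed (§2). The local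
half of KY Prop. 1.2.5's "(eq:Gr to imp) … `∏_{w∈S} H¹(K_w, M_θ)` with `Λ`-cotorsion factors" IN THE
KERNEL. [cite: GreenbergVatsal2000, §2 pp. 20–21] [cite: KellerYin2024, Prop. 1.2.5 (arXiv:2402.12781v2 TeX L780–800)]
[cite: Brink2007, Thm. 2] -/
theorem finite_torsionBy_unrSelmer_quotient (hK : IsImaginaryQuadratic K) (hp : 2 < p) {N : ℕ}
    (hH : SatisfiesHeegnerHypothesis N K) (κ : ZpExtension K p) (hκ : κ.IsAnticyclotomic)
    {γ : absoluteGaloisGroup K} (hγ : κ.IsTopGenerator γ) (vbar : HeightOneSpectrum (𝓞 K))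
    (θ : FramedGaloisRep K (padicCoeffIntegers (∅ : Set (PadicAlgCl p))) 1)
    (Sf : Finset (HeightOneSpectrum (𝓞 K)))
    (hSf : ∀ w : HeightOneSpectrum (𝓞 K), w ∈ Sf ↔ ((N : ℤ) : 𝓞 K) ∈ w.asIdeal) :
    Finite ((↥(unrSelmer κ (charModule (∅ : Set (PadicAlgCl p)) θ) vbar
        (↑Sf : Set (HeightOneSpectrum (𝓞 K)))) ⧸
      (unrSelmer κ (charModule (∅ : Set (PadicAlgCl p)) θ) vbar
          (∅ : Set (HeightOneSpectrum (𝓞 K)))).addSubgroupOf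
        (unrSelmer κ (charModule (∅ : Set (PadicAlgCl p)) θ) vbar
          (↑Sf : Set (HeightOneSpectrum (𝓞 K)))))[(p : ℤ)]) := by
  haveI := finite_torsionBy_charModule θ
  exact finite_torsionBy_quotient κ (M := charModule (∅ : Set (PadicAlgCl p)) θ)
    ⟨1, by rw [natCard_torsionBy_charModule, pow_one]⟩ (exists_nsmul_eq_charModule θ)
    (isOpen_stabilizer_cofree (∅ : Set (PadicAlgCl p)) θ) hγ
    (AcSelmer.bdpData (charModule (∅ : Set (PadicAlgCl p)) θ) p vbar) Sf
    (fun w hw hpw ↦ exists_mem_decomp_apply_ne_one_of_heegner hK hp hH κ hκ w ((hSf w).mp hw) hpw)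

end Quotient

end Summit.BirchSwinnertonDyer.BirchSwinnertonDyer.Theorems.UnrSelmerQuotientTorsionFiniteChar

end
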